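import Summits.SmoothPoincare4.SmoothPoincare4.Theses.SullivanDual
import Literature.Geometry.Symplectic.TamingWitness
import Literature.Geometry.Kaehler.ManifoldFormsProofs
import Literature.NumberTheory.Transcendental.FormIntegrationCharts
import Literature.Geometry.Riemannian.RiemannianMetricExists
import Mathlib.Geometry.Manifold.PartitionOfUnity
import Mathlib.Geometry.Manifold.VectorBundle.Hom

/-!
# Line `Sketch` (pencil-incompleteness), STEP 0(a): every smooth almost complex structure is tamed
by some smooth `2`-form (crux `SullivanDual.WitnessCharge`, item stmt-SmoothPoincare4-7824)

This file states and proves the registered stub `stub_tamingFormExists` (signature verbatim from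
the skeleton of the line): for a homotopy `4`-sphere `Σ`, a point `p` and a smooth almost
complex structure `J` on `Σ ∖ p` (`J² = -1`, smoothness through `inTangentCoordinates`), there is
a SMOOTH `2`-form `β` on `Σ ∖ p` (no closedness asked) with `β(v, Jv) > 0` for every `v ≠ 0`.

## Proof (partition of unity; McDuff–Salamon (2017), §4.1, discussion of `𝒥_τ(M, ω)`)

Mathlib's `exists_contMDiffSection_forall_mem_convex_of_local` (smooth partitions of unity for
sections of a vector bundle with values in convex fibrewise constraints) is applied to Mathlib's
vector bundle `x ↦ T_x M [⋀^Fin 2]→L[ℝ] ℝ` of continuous alternating `2`-forms on the tangent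
bundle (`Bundle.ContinuousAlternatingMap.instVectorBundle`, values trivialized by
`Bundle.Trivial M ℝ`) with the convex constraints `{α | ∀ v ≠ 0, 0 < α(v, J v)}`
(`convex_setOf_tames`). The local sections near `x₀` are the transports `x ↦ A ∘ φ^{x₀}_x` of the
MODEL TAMING FORM `A(a, b) = ⟪J₀ a, b⟫ - ⟪J₀ b, a⟫` (`exists_modelTamingForm`), `J₀` being `J_{x₀}`
read in the tangent trivialization at `x₀`, along the fibre maps `φ^{x₀}_x : T_x M →L[ℝ] E` of that
trivialization (`(trivializationAt E (TangentSpace I) x₀).continuousLinearMapAt ℝ x`):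
* smoothness on the chart domain of `x₀` (`contMDiffOn_compContinuousLinearMap_trivializationAt`):
  in the bundle trivialization at a point `x` the section reads
  `A ∘ (tangent coordinate change from x to x₀)`
  (`trivializationAt_compContinuousLinearMap_trivializationAt`, `Trivialization.coordChangeL`), a
  `C^∞` function of the `C^∞` coordinate change (`contMDiffAt_coordChangeL` for the tangent
  bundle and the tree's `ContDiffAt.continuousAlternatingMapCompContinuousLinearMap`) — Mathlib
  has no `ContMDiffVectorBundle` instance for the bundle of alternating maps, so the hom-bundle
  shortcut `Trivialization.contMDiffOn_section_iff` of `HermitianMetricExists.lean` is not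
  available;
* positivity near `x₀` (`modelTamingForm_pos`): `A(a, J₀ a) = ‖J₀ a‖² + ‖a‖²` and
  `|A(a, K a) - A(a, J₀ a)| ≤ 2 ‖J₀‖ ‖K - J₀‖ ‖a‖²`, applied to `K = J_y` read in the trivialization
  at `x₀`, which is operator-norm close to `J₀` for `y` near `x₀` by the continuity of `J` in
  `inTangentCoordinates` (the smoothness hypothesis of the crux).
The resulting `C^∞` section is a smooth form in the tree's chart-wise sense by
`isSmoothForm_iff_contMDiff_totalSpace_holds` (`ManifoldFormsProofs.lean`). The punctured manifold
is Hausdorff and σ-compact (open subset of a second-countable manifold on `ℝ⁴`).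

The general statement is `exists_isSmoothForm_tames` (any `C^∞` manifold with corners on a
finite-dimensional inner product space, Hausdorff and σ-compact; continuity of `J` in
`inTangentCoordinates` suffices); `stub_tamingFormExists` is its specialization.

## References

* D. McDuff, D. Salamon, *Introduction to Symplectic Topology*, 3rd ed. (2017), §2.5, §4.1
  (tame almost complex structures; every `J` admits a `J`-invariant metric `g`, and `g(J·, ·)`
  is a nondegenerate form taming `J`). [McDuffSalamon2017]
* C. Voisin, *Hodge Theory and Complex Algebraic Geometry I* (2002), Ch. 3, p. 63 (partition of
  unity over local trivializations of the tangent bundle), the templates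
  `Literature.Geometry.Kaehler.exists_isHermitian_contMDiffRiemannianMetric` and
  `Literature.Geometry.Riemannian.exists_isRiemannian` (whose
  `continuousLinearMapAt_tangent_ne_zero` is reused).
-/

noncomputable section

-- the prescribed namespace `Summit.<P>.<Sub>.…` duplicates `SmoothPoincare4` (P = Sub)
set_option linter.dupNamespace false

open scoped Manifold ContDiff Topology InnerProductSpace
open Set Filter Bundle Literature.Geometry.Kaehler Literature.Geometry.Symplectic
  Literature.Topology.FourManifolds Literature.NumberTheory.Transcendental

namespace Summit.SmoothPoincare4.SmoothPoincare4.Theorems.WitnessCharge.PencilIncompleteness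

/-! ### The model taming form of a linear complex structure on an inner product space -/

section Model

variable {V : Type*} [NormedAddCommGroup V] [InnerProductSpace ℝ V]

/-- The **model taming form** of an endomorphism `J₀` of a real inner product space exists as a
continuous alternating map: `A(a, b) = ⟪J₀ a, b⟫ - ⟪J₀ b, a⟫`, the antisymmetrisation of
`⟪J₀ ·, ·⟫` (built, as the tree's `Bundle.RiemannianMetric.kaehlerForm`, with Mathlib's
`ContinuousMultilinearMap.alternatization`). For a complex structure `J₀` it tames `J₀`:
`A(a, J₀ a) = ‖J₀ a‖² + ‖a‖²` (McDuff–Salamon (2017), §2.5: `ω(v, Jv) > 0`). [folklore] -/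
theorem exists_modelTamingForm (J₀ : V →L[ℝ] V) :
    ∃ A : V [⋀^Fin 2]→L[ℝ] ℝ, ∀ a b : V, A ![a, b] = ⟪J₀ a, b⟫_ℝ - ⟪J₀ b, a⟫_ℝ := by
  refine ⟨ContinuousMultilinearMap.alternatization
    (ContinuousLinearMap.uncurryLeft
      (((continuousMultilinearCurryFin1 ℝ V ℝ).symm : (V →L[ℝ] ℝ) →L[ℝ] _).comp
        ((innerSL ℝ).comp J₀))), fun a b ↦ ?_⟩
  rw [ContinuousMultilinearMap.alternatization_apply_apply]
  have huniv : (Finset.univ : Finset (Equiv.Perm (Fin 2))) = {1, Equiv.swap 0 1} := by decide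
  rw [huniv, Finset.sum_pair (by decide)]
  simp [Equiv.Perm.sign_swap', Units.smul_def, sub_eq_add_neg]

/-- **Uniform positivity of the model taming form near `J₀`.** If `A(a, b) = ⟪J₀ a, b⟫ - ⟪J₀ b, a⟫`
with `J₀² = -1` and the endomorphism `K` is operator-norm close to `J₀`, `2 ‖J₀‖ ‖K - J₀‖ < 1`,
then `A(a, K a) > 0` for every `a ≠ 0`:
`A(a, K a) = ‖J₀ a‖² + ‖a‖² + ⟪J₀ a, (K - J₀) a⟫ - ⟪J₀ (K - J₀) a, a⟫ ≥ (1 - 2‖J₀‖‖K - J₀‖) ‖a‖²`.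
[folklore] -/
theorem modelTamingForm_pos {J₀ K : V →L[ℝ] V} {A : V [⋀^Fin 2]→L[ℝ] ℝ}
    (hA : ∀ a b : V, A ![a, b] = ⟪J₀ a, b⟫_ℝ - ⟪J₀ b, a⟫_ℝ) (hJ : ∀ a, J₀ (J₀ a) = -a)
    (hK : 2 * ‖J₀‖ * ‖K - J₀‖ < 1) {a : V} (ha : a ≠ 0) : 0 < A ![a, K a] := by
  rw [hA]
  have hKa : K a = J₀ a + (K - J₀) a := by simp
  have h1 : |⟪J₀ a, (K - J₀) a⟫_ℝ| ≤ ‖J₀‖ * ‖K - J₀‖ * ‖a‖ ^ 2 := by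
    calc |⟪J₀ a, (K - J₀) a⟫_ℝ| ≤ ‖J₀ a‖ * ‖(K - J₀) a‖ := abs_real_inner_le_norm _ _
      _ ≤ (‖J₀‖ * ‖a‖) * (‖K - J₀‖ * ‖a‖) :=
          mul_le_mul (J₀.le_opNorm a) ((K - J₀).le_opNorm a) (norm_nonneg _) (by positivity)
      _ = ‖J₀‖ * ‖K - J₀‖ * ‖a‖ ^ 2 := by ring
  have h2 : |⟪J₀ ((K - J₀) a), a⟫_ℝ| ≤ ‖J₀‖ * ‖K - J₀‖ * ‖a‖ ^ 2 := by
    calc |⟪J₀ ((K - J₀) a), a⟫_ℝ| ≤ ‖J₀ ((K - J₀) a)‖ * ‖a‖ := abs_real_inner_le_norm _ _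
      _ ≤ (‖J₀‖ * (‖K - J₀‖ * ‖a‖)) * ‖a‖ := by
          gcongr
          exact (J₀.le_opNorm _).trans
            (mul_le_mul_of_nonneg_left ((K - J₀).le_opNorm a) (norm_nonneg _))
      _ = ‖J₀‖ * ‖K - J₀‖ * ‖a‖ ^ 2 := by ring
  have ha2 : 0 < ‖a‖ ^ 2 := by positivity
  have hprod : 0 < (1 - 2 * ‖J₀‖ * ‖K - J₀‖) * ‖a‖ ^ 2 := mul_pos (sub_pos.2 hK) ha2
  obtain ⟨h1a, -⟩ := abs_le.1 h1
  obtain ⟨-, h2b⟩ := abs_le.1 h2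
  rw [hKa, inner_add_right, map_add, inner_add_left, hJ, inner_neg_left,
    real_inner_self_eq_norm_sq, real_inner_self_eq_norm_sq]
  nlinarith [sq_nonneg ‖J₀ a‖]

end Model

/-! ### Transporting a model form along the tangent trivializations -/

section Transport

variable {E : Type*} [NormedAddCommGroup E] [NormedSpace ℝ E] {H : Type*} [TopologicalSpace H]
  {I : ModelWithCorners ℝ E H} {M : Type*} [TopologicalSpace M] [ChartedSpace H M]
  [IsManifold I ∞ M] {k : ℕ}

/-- **The transported section in a bundle chart.** Write `φ^{x₀}_x : T_x M →L[ℝ] E` for the fibre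
map `(trivializationAt E (TangentSpace I) x₀).continuousLinearMapAt ℝ x` of the tangent
trivialization at `x₀` ("local trivialisations of the tangent bundle", Voisin (2002), Ch. 3,
p. 63). The transport `x ↦ A ∘ φ^{x₀}_x = A.compContinuousLinearMap φ^{x₀}_x` of a `k`-form `A`
on the model space (junk `0` off the chart domain of `x₀`) reads, in the trivialization at `x` of
Mathlib's bundle of continuous alternating maps on the tangent bundle and over `y`, as the
pull-back of `A` along `φ^{x₀}_y ∘ (φ^{x}_y)⁻¹` (the values being trivialized by the identity of
`Bundle.Trivial M ℝ`). [folklore] -/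
theorem trivializationAt_compContinuousLinearMap_trivializationAt (A : E [⋀^Fin k]→L[ℝ] ℝ)
    (x₀ x y : M) :
    (trivializationAt (E [⋀^Fin k]→L[ℝ] ℝ) (fun z : M ↦ TangentSpace I z [⋀^Fin k]→L[ℝ] ℝ) x
        ⟨y, A.compContinuousLinearMap
          ((trivializationAt E (TangentSpace I) x₀).continuousLinearMapAt ℝ y)⟩).2 =
      A.compContinuousLinearMap
        (((trivializationAt E (TangentSpace I) x₀).continuousLinearMapAt ℝ y).comp
          ((trivializationAt E (TangentSpace I) x).symmL ℝ y)) := by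
  rw [FiberBundle.trivializationAt_continuousAlternatingMap_apply]
  ext v
  simp [ContinuousAlternatingMap.inCoordinates, Bundle.Trivial.fiberBundle_trivializationAt',
    Bundle.Trivial.continuousLinearMapAt_trivialization, Function.comp_def]

/-- On the common chart domain of `x` and `x₀`, `φ^{x₀}_y ∘ (φ^{x}_y)⁻¹` is the coordinate change
`coordChangeL` of the tangent bundle from the trivialization at `x` to that at `x₀`. [folklore] -/
theorem continuousLinearMapAt_comp_symmL_eq_coordChangeL {x₀ x y : M}
    (hy : y ∈ (chartAt H x).source) (hy₀ : y ∈ (chartAt H x₀).source) :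
    ((trivializationAt E (TangentSpace I) x₀).continuousLinearMapAt ℝ y).comp
        ((trivializationAt E (TangentSpace I) x).symmL ℝ y) =
      ((trivializationAt E (TangentSpace I) x).coordChangeL ℝ
        (trivializationAt E (TangentSpace I) x₀) y : E →L[ℝ] E) := by
  have hy' : y ∈ (trivializationAt E (TangentSpace I) x).baseSet := by simpa using hy
  have hy₀' : y ∈ (trivializationAt E (TangentSpace I) x₀).baseSet := by simpa using hy₀
  ext v
  rw [ContinuousLinearMap.comp_apply, ContinuousLinearEquiv.coe_coe,
    Trivialization.coordChangeL_apply _ _ ⟨hy', hy₀'⟩,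
    Trivialization.continuousLinearMapAt_apply_of_mem (R := ℝ) (hb := hy₀'),
    Trivialization.symmL_apply _ hy']

/-- Pulling a FIXED alternating form back along a variable continuous linear map is `C^∞` in the
linear map (a continuous homogeneous polynomial map of degree `k`). [folklore] -/
theorem contDiff_compContinuousLinearMap_const (A : E [⋀^Fin k]→L[ℝ] ℝ) :
    ContDiff ℝ ∞ (fun L : E →L[ℝ] E ↦ A.compContinuousLinearMap L) :=
  contDiff_iff_contDiffAt.2 fun _ ↦
    (contDiffAt_const (c := A)).continuousAlternatingMapCompContinuousLinearMap contDiffAt_id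

/-- **The transported section is `C^∞` over the chart domain of `x₀`** as a section of Mathlib's
bundle of continuous alternating maps on the tangent bundle: near each `x` of that domain, in the
bundle chart at `x`, it is `A` pulled back along the `C^∞` tangent coordinate change
(`contMDiffAt_coordChangeL`; Mathlib has no `ContMDiffVectorBundle` instance for the bundle of
alternating maps, so the trivialization at `x₀` cannot be used away from `x₀` directly).
[folklore] -/
theorem contMDiffOn_compContinuousLinearMap_trivializationAt (A : E [⋀^Fin k]→L[ℝ] ℝ) (x₀ : M) :
    ContMDiffOn I (I.prod 𝓘(ℝ, E [⋀^Fin k]→L[ℝ] ℝ)) ∞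
      (fun x ↦ TotalSpace.mk' (E [⋀^Fin k]→L[ℝ] ℝ)
        (E := fun z : M ↦ TangentSpace I z [⋀^Fin k]→L[ℝ] ℝ) x
        (A.compContinuousLinearMap
          ((trivializationAt E (TangentSpace I) x₀).continuousLinearMapAt ℝ x)))
      (chartAt H x₀).source := by
  intro x hx
  rw [Bundle.contMDiffWithinAt_section]
  simp_rw [trivializationAt_compContinuousLinearMap_trivializationAt]
  have hx' : x ∈ (trivializationAt E (TangentSpace I) x).baseSet := by simp
  have hx₀' : x ∈ (trivializationAt E (TangentSpace I) x₀).baseSet := by simpa using hx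
  have hcc := contMDiffAt_coordChangeL (IB := I) (n := ∞)
    (e := trivializationAt E (TangentSpace I) x) (e' := trivializationAt E (TangentSpace I) x₀)
    hx' hx₀'
  have hsm : ContMDiffAt I 𝓘(ℝ, E [⋀^Fin k]→L[ℝ] ℝ) ∞
      (fun y ↦ A.compContinuousLinearMap
        ((trivializationAt E (TangentSpace I) x).coordChangeL ℝ
          (trivializationAt E (TangentSpace I) x₀) y : E →L[ℝ] E)) x :=
    (contDiff_compContinuousLinearMap_const A).comp_contMDiffAt hcc
  refine (hsm.congr_of_eventuallyEq ?_).contMDiffWithinAt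
  filter_upwards [(chartAt H x).open_source.mem_nhds (mem_chart_source H x),
    (chartAt H x₀).open_source.mem_nhds hx] with y hy hy₀
  rw [continuousLinearMapAt_comp_symmL_eq_coordChangeL hy hy₀]

/-- **`J` read in the tangent trivialization.** For a field of endomorphisms `J` of the tangent
spaces and `x` in the chart domain of `x₀`, the trivialization map `φₓ = φ^{x₀}_x` intertwines
`J x` with its coordinate expression `inTangentCoordinates I I id id J x₀ x = φₓ ∘ J x ∘ φₓ⁻¹`:
`φₓ (J x v) = (inTangentCoordinates … x₀ x) (φₓ v)`. [folklore] -/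
theorem continuousLinearMapAt_apply_eq_inTangentCoordinates
    (J : ∀ x : M, TangentSpace I x →L[ℝ] TangentSpace I x) {x₀ x : M}
    (hx : x ∈ (chartAt H x₀).source) (v : TangentSpace I x) :
    (trivializationAt E (TangentSpace I) x₀).continuousLinearMapAt ℝ x (J x v) =
      inTangentCoordinates I I (id : M → M) id (fun x ↦ J x) x₀ x
        ((trivializationAt E (TangentSpace I) x₀).continuousLinearMapAt ℝ x v) := by
  have hx' : x ∈ (trivializationAt E (TangentSpace I) x₀).baseSet := by simpa using hx
  simp only [inTangentCoordinates, ContinuousLinearMap.inCoordinates, id_eq,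
    ContinuousLinearMap.comp_apply]
  rw [Trivialization.symmL_continuousLinearMapAt _ hx']

/-- At the centre `x₀` itself, the coordinate expression `J₀ = inTangentCoordinates … x₀ x₀` of a
field of complex structures (`J² = -1`) is again a complex structure: `J₀² = -1`. [folklore] -/
theorem inTangentCoordinates_self_sq (J : ∀ x : M, TangentSpace I x →L[ℝ] TangentSpace I x)
    (hJ : ∀ (x : M) (v : TangentSpace I x), J x (J x v) = -v) (x₀ : M) (a : E) :
    inTangentCoordinates I I (id : M → M) id (fun x ↦ J x) x₀ x₀
        (inTangentCoordinates I I (id : M → M) id (fun x ↦ J x) x₀ x₀ a) = -a := by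
  have hx' : x₀ ∈ (trivializationAt E (TangentSpace I) x₀).baseSet := by simp
  simp only [inTangentCoordinates, ContinuousLinearMap.inCoordinates, id_eq,
    ContinuousLinearMap.comp_apply]
  rw [Trivialization.symmL_continuousLinearMapAt _ hx', hJ, map_neg,
    Trivialization.continuousLinearMapAt_symmL _ hx']

end Transport

/-! ### Taming forms by partition of unity -/

section Existence

variable {E : Type*} [NormedAddCommGroup E] [InnerProductSpace ℝ E] {H : Type*}
  [TopologicalSpace H] {I : ModelWithCorners ℝ E H} {M : Type*} [TopologicalSpace M]
  [ChartedSpace H M]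

/-- The fibrewise constraint of the construction, the set `{α | ∀ v ≠ 0, 0 < α(v, J x v)}` of
alternating `2`-forms on `T_x M` taming `J x` (McDuff–Salamon (2017), (4.1.1)), is convex (a
convex combination of forms positive on the pairs `(v, Jv)` is positive on them). [folklore] -/
theorem convex_setOf_tames (J : ∀ x : M, TangentSpace I x →L[ℝ] TangentSpace I x) (x : M) :
    Convex ℝ {α : TangentSpace I x [⋀^Fin 2]→L[ℝ] ℝ |
      ∀ v : TangentSpace I x, v ≠ 0 → 0 < α ![v, J x v]} := by
  rintro α₁ h₁ α₂ h₂ a b ha hb hab v hv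
  have e₁ := h₁ v hv
  have e₂ := h₂ v hv
  simp only [ContinuousAlternatingMap.add_apply, ContinuousAlternatingMap.smul_apply, smul_eq_mul]
  rcases ha.eq_or_lt with rfl | ha'
  · rw [zero_add] at hab
    rw [hab]
    nlinarith
  · nlinarith [mul_pos ha' e₁, mul_nonneg hb e₂.le]

variable [IsManifold I ∞ M]

/-- **Local taming sections.** Let `J` be a field of complex structures on the tangent spaces of
`M` (`J² = -1`) whose coordinate expression `inTangentCoordinates I I id id J x₀` in the tangent
trivialization at `x₀` is continuous at `x₀`. Then on a neighbourhood `U` of `x₀` there is a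
`C^∞` section of the bundle of alternating `2`-forms taming `J`: the transport `A ∘ φ^{x₀}` of
the model taming form `A` of `J₀ = inTangentCoordinates … x₀ x₀` (`exists_modelTamingForm`) along
the tangent trivialization at `x₀`, on `U = (chart domain of x₀) ∩ {‖J_y - J₀‖ < δ}` (`J_y` read
in the trivialization), `δ = 1 / (2‖J₀‖ + 1)` (`modelTamingForm_pos`). [folklore] -/
theorem exists_local_tamingSection (J : ∀ x : M, TangentSpace I x →L[ℝ] TangentSpace I x)
    (hJ : ∀ (x : M) (v : TangentSpace I x), J x (J x v) = -v) (x₀ : M)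
    (hJc : ContinuousAt (inTangentCoordinates I I (id : M → M) id (fun x ↦ J x) x₀) x₀) :
    ∃ U ∈ 𝓝 x₀, ∃ s : (x : M) → TangentSpace I x [⋀^Fin 2]→L[ℝ] ℝ,
      ContMDiffOn I (I.prod 𝓘(ℝ, E [⋀^Fin 2]→L[ℝ] ℝ)) ∞
        (fun x ↦ TotalSpace.mk' (E [⋀^Fin 2]→L[ℝ] ℝ)
          (E := fun z : M ↦ TangentSpace I z [⋀^Fin 2]→L[ℝ] ℝ) x (s x)) U ∧
      ∀ y ∈ U, ∀ v : TangentSpace I y, v ≠ 0 → 0 < s y ![v, J y v] := by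
  set Jc := inTangentCoordinates I I (id : M → M) id (fun x ↦ J x) x₀
  set J₀ := Jc x₀
  have hJ₀ : ∀ a, J₀ (J₀ a) = -a := inTangentCoordinates_self_sq J hJ x₀
  obtain ⟨A, hA⟩ := exists_modelTamingForm J₀
  set δ : ℝ := 1 / (2 * ‖J₀‖ + 1) with hδ_def
  have hden : 0 < 2 * ‖J₀‖ + 1 := by positivity
  have hδ : 0 < δ := by positivity
  refine ⟨(chartAt H x₀).source ∩ Jc ⁻¹' Metric.ball J₀ δ,
    inter_mem ((chartAt H x₀).open_source.mem_nhds (mem_chart_source H x₀))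
      (hJc.preimage_mem_nhds (Metric.ball_mem_nhds J₀ hδ)),
    fun x ↦ A.compContinuousLinearMap
      ((trivializationAt E (TangentSpace I) x₀).continuousLinearMapAt ℝ x),
    (contMDiffOn_compContinuousLinearMap_trivializationAt A x₀).mono inter_subset_left, ?_⟩
  rintro y ⟨hy, hyJ⟩ v hv
  have hK : 2 * ‖J₀‖ * ‖Jc y - J₀‖ < 1 := by
    have hlt : ‖Jc y - J₀‖ < δ := by simpa [dist_eq_norm] using hyJ
    calc 2 * ‖J₀‖ * ‖Jc y - J₀‖ ≤ 2 * ‖J₀‖ * δ := by gcongr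
      _ < 1 := by
        rw [hδ_def, ← mul_div_assoc, mul_one, div_lt_one hden]
        linarith
  have hφv := Literature.Geometry.Riemannian.continuousLinearMapAt_tangent_ne_zero (I := I) hy hv
  set φ := (trivializationAt E (TangentSpace I) x₀).continuousLinearMapAt ℝ y
  have key : (fun i ↦ φ (![v, J y v] i)) = ![φ v, Jc y (φ v)] := by
    funext i
    fin_cases i
    · rfl
    · exact continuousLinearMapAt_apply_eq_inTangentCoordinates J hy v
  rw [ContinuousAlternatingMap.compContinuousLinearMap_apply, Function.comp_def, key]
  exact modelTamingForm_pos hA hJ₀ hK hφv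

/-- **Every continuous field of complex structures is tamed by a smooth `2`-form.** On a `C^∞`
manifold `M` (any model with corners on a finite-dimensional real inner product space; Hausdorff
and σ-compact, so that smooth partitions of unity exist), a field `J` of complex structures of the
tangent spaces (`J² = -1`) whose coordinate expressions `inTangentCoordinates I I id id J x₀` are
continuous at the centres `x₀` is tamed by a SMOOTH `2`-form `β` (`IsSmoothForm β`,
`β(v, Jv) > 0` for `v ≠ 0`; no closedness). Proof: Mathlib's
`exists_contMDiffSection_forall_mem_convex_of_local` for the bundle of alternating `2`-forms on the
tangent bundle and the convex constraints `convex_setOf_tames`, with the local sections of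
`exists_local_tamingSection`; the `C^∞` section is a smooth form by
`isSmoothForm_iff_contMDiff_totalSpace_holds`. McDuff–Salamon (2017), §4.1 (every almost
complex structure is tamed by the nondegenerate form `g(J·, ·)` of a `J`-invariant metric).
[folklore] -/
theorem exists_isSmoothForm_tames [FiniteDimensional ℝ E] [T2Space M] [SigmaCompactSpace M]
    (J : ∀ x : M, TangentSpace I x →L[ℝ] TangentSpace I x)
    (hJ : ∀ (x : M) (v : TangentSpace I x), J x (J x v) = -v)
    (hJc : ∀ x₀ : M, ContinuousAt (inTangentCoordinates I I (id : M → M) id (fun x ↦ J x) x₀) x₀) :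
    ∃ β : MForm I M ℝ 2, IsSmoothForm β ∧
      ∀ (x : M) (v : TangentSpace I x), v ≠ 0 → 0 < β x ![v, J x v] := by
  obtain ⟨s, hs⟩ := exists_contMDiffSection_forall_mem_convex_of_local (n := ⊤) I
    (fun x : M ↦ TangentSpace I x [⋀^Fin 2]→L[ℝ] ℝ)
    (fun x ↦ {α | ∀ v : TangentSpace I x, v ≠ 0 → 0 < α ![v, J x v]}) (convex_setOf_tames J)
    fun x₀ ↦ exists_local_tamingSection J hJ x₀ (hJc x₀)
  exact ⟨fun x ↦ s x, (isSmoothForm_iff_contMDiff_totalSpace_holds I M ℝ (fun x ↦ s x)).2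
    s.contMDiff, fun x v hv ↦ hs x v hv⟩

end Existence

/-- STEP 0(a) — **a smooth almost complex structure on `Σ ∖ p` is tamed by some smooth `2`-form**
(no closedness asked): partition of unity over charts, locally `α(v, w) = ⟨J₀ v, w⟩ - ⟨J₀ w, v⟩`
with `J₀ = J_{x₀}` frozen in the tangent trivialization at `x₀` (`exists_isSmoothForm_tames`,
specialized to the open submanifold `Σ ∖ p` of the closed `4`-manifold `Σ`, which is Hausdorff
and σ-compact: open in a second-countable manifold on `ℝ⁴`). Consequence used by the line: (W1)
makes a witness an order-`0` functional supported in `K_ε`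
(`TamingWitness.eq_zero_of_vanishes_off_ball`). [folklore] -/
theorem stub_tamingFormExists :
    ∀ (S : HomotopySphere 4) (p : S.carrier)
      (J : ∀ x : punctured p, TangentSpace (𝓡 4) x →L[ℝ] TangentSpace (𝓡 4) x),
      (∀ (x : punctured p) (v : TangentSpace (𝓡 4) x), J x (J x v) = -v) →
      (∀ x₀ : punctured p, ContMDiffAt (𝓡 4) 𝓘(ℝ, EuclideanSpace ℝ (Fin 4) →L[ℝ] EuclideanSpace ℝ (Fin 4)) ∞
        (inTangentCoordinates (𝓡 4) (𝓡 4) (id : punctured p → punctured p) id (fun x => J x) x₀) x₀) →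
      ∃ β : MForm (𝓡 4) (punctured p) ℝ 2, IsSmoothForm β ∧
        ∀ (x : punctured p) (v : TangentSpace (𝓡 4) x), v ≠ 0 → 0 < β x ![v, J x v] := by
  intro S p J hJ hJs
  haveI : LocallyCompactSpace S.carrier :=
    ChartedSpace.locallyCompactSpace (EuclideanSpace ℝ (Fin 4)) S.carrier
  haveI : LocallyCompactSpace (punctured p) := (punctured p).2.locallyCompactSpace
  exact exists_isSmoothForm_tames J hJ fun x₀ ↦ (hJs x₀).continuousAt

end Summit.SmoothPoincare4.SmoothPoincare4.Theorems.WitnessCharge.PencilIncompleteness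

end
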